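/-
Copyright: the b2b-balaban T⁴-continuum CRUX team, row NE7b owner lineage `t4-ne7b-p1` (gen 112). Project licence.
-/
import Summits.QuantumFields.BalabanUV.T4Continuum.Spine.NE7b.OneShotChartFibreSum
import Summits.QuantumFields.BalabanUV.T4Continuum.Spine.NE7b.OneShotChartFourier

/-!
# THE ONE-SHOT CHART CONSTANT OF THE FREE FIELD IS AT MOST `(π∕2)^d` — THE PLANCHEREL JUNCTION: for the scalar
# `H = G′Q′*(Q′G′Q′*)⁻¹` of [B5] (1.103) on the whole lattice `ℤ^d` and EVERY block side `n + 1`, every `a > 0`, every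
# square-summable coarse field `B`:  `(n+1)^{−d} Σ′_z (H B)(z)² ≤ (π²∕4)^d Σ′_y B(y)²` — the tree's mesh-uniform certificate
# `B5HkUniformL2Zd.tsum_HBZd_sq_le_uniform` with its constant `(c_H K_d)² ≈ 10^{733}` REPLACED BY `(π²∕4)^d` (`< 37.21` at d = 4)
# (row NE7b, node U5c; CLAIM C-ne7bp1-g111-1 closed in the kernel; Literature B4∕B5∕B6 columns + Mathlib + (39)(40)(41))

Cell `pub-balaban`, sub-cell `t4`, spine estimate NE7b (`T4WeightBudget.RelWeightBound`; the cell's OWN estimate — NOT PRINTED in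
[Bałaban 1983–89], NOT PROVED).  Crux-route work under `Spine/NE7b/` by the row OWNER (`t4-ne7b-p1` gen 112) under FREEZE (0)'s
crux-prover clause (RULING W-ne7bp1-g112-1); NOTHING of Bałaban's is asserted; no `T4Continuum/Support` leaf typed; no `def`; zero
`sorry`.  Imports: (40) `OneShotChartFibreSum` (the multiplier bound `Σ_τ‖G_τ‖² ≤ N^d(π²∕4)^d symbR²`) and (41) `OneShotChartFourier`
(`H(chart n x τ, y) = latticeKernel (G_τ∕symbQGQ)(x − y)`), hence the scalar `ℤ^d` column of the Literature.

WHY.  CLAIM C-ne7bp1-g111-1 (journal [NE7bP1-G111-RULING3], PRICING-NE7b v120 F711–F713): the one-shot chart letter of the hard-step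
cell — the `η`-norm of the free critical section `H_M`, block-mean averaging of composite side `M = n+1`, massless scalar field — is
at most `(π∕2)^d` for EVERY `M`, against the consumer threshold `M^{(d−2)∕2}` (leaf-01's HRS); the tree's only certificate by value,
`tsum_HBZd_sq_le_uniform`, carries `c_H K_d = 10^{366.6}` (F711: true, unusable).  (39) proved the model-free fibre bound, (40) the
fibre sum for the tree's multipliers, (41) the Fourier form of the tree's `H`; this file assembles them: block row by block row
`H B` is the Fourier-coefficient sequence of `(G_τ∕symbQGQ)·B̂` (finitely supported `B`), BESSEL (`B4Eq246SquareSummable`) bounds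
each row's `ℓ²`-mass by `(2π)^{−d}∫‖G_τ‖²‖B̂‖²∕symbR²`, the rows add up to `(2π)^{−d}∫(Σ_τ‖G_τ‖²)‖B̂‖²∕symbR² ≤ (n+1)^d(π²∕4)^d
(2π)^{−d}∫‖B̂‖² = (n+1)^d(π²∕4)^d Σ_y B(y)²` ((40) + `B5Momentum166Zd.integral_FTsq`), and square-summable `B` follow by
exhausting `ℤ^d` with finite windows (every row series of `H B` converges absolutely, `B5Hk165L2Zd.summable_HBZd_row`).

WHAT IS PROVED ([folklore] assembly; `n : ℕ`, `a > 0`):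
* §1 `HB_chart_eq_latticeKernel`: for a finite window `T`, `(H B)(chart n x τ) = latticeKernel ((G_τ∕symbQGQ)·B̂_T)(x)`,
  `B̂_T(P) = Σ_{y∈T} B(y)e^{−iP·y}`; `Bhat_ofRealVec` (`= B5Momentum166Zd.FT`), `norm_Bhat_sq` (`= FTsq`), continuity.
* §2 `tsum_row_sq_le` (Bessel per block row), `integrand_sum_le` (the (40) bound under the integral), **`tsum_HB_sq_le_sharp`**:
  `Σ′_z (HB n a T B)(z)² ≤ (n+1)^d (π²∕4)^d Σ_{y∈T} B(y)²` for EVERY finite `T`.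
* §3 **`tsum_HBZd_sq_le_sharp`** — THE HEADLINE: `Σ′_z (H B)(z)² ≤ (n+1)^d (π²∕4)^d Σ′_y B(y)²` for every square-summable `B`;
  **`tsum_HBZd_sq_le_uniform_sharp`**: `((n+1)^d)⁻¹ Σ′_z (H B)(z)² ≤ (π²∕4)^d Σ′_y B(y)²` (the statement of
  `B5HkUniformL2Zd.tsum_HBZd_sq_le_uniform` with the constant `(π²∕4)^d`); `tsum_HBZd_sq_le_uniform_d4` (d = 4: `< 37.21·‖B‖²`,
  i.e. `‖H_M‖_η < 6.1` for every `M`).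

NOT HERE (honest): the sharp value `sup_M ‖H_M‖_η = 1.326` (d = 4) and the two finite levels `M = 2, 4` at `L = 2` where `(π∕2)^4 = 6.09`
does not beat the consumer threshold `M` (NC-NE7b-β (β0), a calc request); Bałaban's vector ∕ covariant `H_k` with the axial gauge
((A3), NC-NE7b-α UNRULED); the torus.  BY-NAME EFFECT ON THE WALL: NONE — this closes the one-shot CHART letter of the hard-step cell's
Gaussian skeleton by value for `M ≥ 8` (d = 4), nothing of `RelWeightBound`.  NE7b NOT PRINTED ∕ NOT PROVED; spine PROVED 0∕9; rung
(B)+1 on a FINITE torus — NOT infinite volume, NOT the mass gap, NOT Clay.  HONEST DEPENDENCY: continuum YM on T⁴ ⇐ BetaPertH ∧ nine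
spine estimates (0∕9 proved); BetaPertH ⇐ (D1) ∧ (D4) ∧ CAP+tail; G-an2-4 gates asym, D1 and NE2∕3∕4.
-/

set_option autoImplicit false

namespace Summit.QuantumFields.BalabanUV.T4Continuum.NE7b.OneShotChartBound

open Finset Complex MeasureTheory Filter Topology
open Literature.MathematicalPhysics.QuantumFieldTheory.Balaban1983to89
open B4Strip (ofRealVec)
open B4StripSums (G)
open B4ContourShift (BZ latticeKernel integrand)
open B4Green244 (latticeKernel_phase_mul latticeKernel_sum_mul phaseC phaseC_ofRealVec)
open B6QGQLower276 (X B blk chart)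
open B5Hk103ScalarZd (kerH tsum_blocks)
open B5Hk103Minimizer (HB)
open B5Hk165L2Zd (HBZd summable_HBZd_row summable_HBZd_sq)
open B5Momentum166Zd (FT FTsq normSq_FT integral_FTsq continuous_FTsq isCompact_BZ measurableSet_BZ phaseC_eq)
open B5Ineq167SymbolZd (phase phase_sub phase_zero)
open B6QGQFourier275Zd (symbQGQ symbQGQ_ofReal symbR symbR_ge twoGamma0_pos continuous_cexp_phase sum_B_eq)
open B4Eq246SquareSummable (summable_normSq_latticeKernel tsum_normSq_latticeKernel_le)
open OneShotChartFibreBound (pi_sq_div_four_pow_four_lt)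
open OneShotChartFibreSum (sum_normSq_G_le)
open OneShotChartFourier (kerH_chart_eq_latticeKernel continuousOn_G_div integrableOn_integrand_of_continuousOn symbQGQ_ne_zero)
open scoped Real

noncomputable section

variable {d : ℕ}

/-! ## §1. Block rows of `H B` for a finite window `T` are Fourier coefficients of `(G_τ∕symbQGQ)·B̂_T` -/

/-- `p·(−y) = −p·y`. [folklore] -/
theorem phase_neg (p : Fin d → ℝ) (y : X d) : phase p (-y) = -phase p y := by
  have h := phase_sub p 0 y
  rwa [zero_sub, phase_zero, zero_sub] at h

/-- on the real zone the transform `Σ_{y∈T} B(y)e^{iP·(−y)}` is the column's `FT T B` ((1.29) at `η = 1`). [folklore] -/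
theorem Bhat_ofRealVec (T : Finset (X d)) (Bf : X d → ℝ) (p : Fin d → ℝ) :
    (∑ y ∈ T, (Bf y : ℂ) * cexp (I * phaseC (ofRealVec p) (-y))) = FT T Bf p := by
  unfold FT
  refine Finset.sum_congr rfl fun y _ => ?_
  rw [phaseC_ofRealVec, phaseC_eq, phase_neg, mul_comm I]

/-- `‖B̂_T(p)‖² = FTsq T B p`. [folklore] -/
theorem norm_Bhat_sq (T : Finset (X d)) (Bf : X d → ℝ) (p : Fin d → ℝ) :
    ‖∑ y ∈ T, (Bf y : ℂ) * cexp (I * phaseC (ofRealVec p) (-y))‖ ^ 2 = FTsq T Bf p := by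
  rw [Bhat_ofRealVec, Complex.sq_norm, normSq_FT]

/-- `p ↦ B̂_T(p)` is continuous. [folklore] -/
theorem continuous_Bhat (T : Finset (X d)) (Bf : X d → ℝ) :
    Continuous fun p : Fin d → ℝ => ∑ y ∈ T, (Bf y : ℂ) * cexp (I * phaseC (ofRealVec p) (-y)) := by
  refine continuous_finsetSum _ fun y _ => continuous_const.mul ?_
  simp_rw [phaseC_ofRealVec]
  exact continuous_cexp_phase (-y)

/-- the row multiplier `(G_τ∕symbQGQ)·B̂_T` is continuous on the zone. [folklore] -/
theorem continuousOn_rowMult (n : ℕ) {a : ℝ} (ha : 0 < a) (τ : Fin d → Fin (n + 1)) (T : Finset (X d)) (Bf : X d → ℝ) :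
    ContinuousOn (fun p : Fin d → ℝ => G (n + 1) a 0 τ (ofRealVec p) / symbQGQ (n + 1) a (ofRealVec p)
      * ∑ y ∈ T, (Bf y : ℂ) * cexp (I * phaseC (ofRealVec p) (-y))) (BZ d) :=
  (continuousOn_G_div n ha τ).mul (continuous_Bhat T Bf).continuousOn

/-- **BLOCK ROWS OF `H B` ARE FOURIER COEFFICIENTS**: for a finite window `T`,
`(H B)(chart n x τ) = Σ_{y∈T} B(y)H(chart n x τ, y) = (2π)^{−d}∫ (G_τ∕symbQGQ)(p′)·B̂_T(p′) e^{ip′·x} dp′`. [folklore] -/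
theorem HB_chart_eq_latticeKernel (n : ℕ) {a : ℝ} (ha : 0 < a) (T : Finset (X d)) (Bf : X d → ℝ) (x : X d)
    (τ : Fin d → Fin (n + 1)) :
    ((HB n a T Bf (chart n x τ) : ℝ) : ℂ)
      = latticeKernel (fun P => G (n + 1) a 0 τ P / symbQGQ (n + 1) a P
          * ∑ y ∈ T, (Bf y : ℂ) * cexp (I * phaseC P (-y))) x := by
  have hint : ∀ y ∈ T, IntegrableOn
      (integrand (fun P => cexp (I * phaseC P (-y)) * (G (n + 1) a 0 τ P / symbQGQ (n + 1) a P)) x) (BZ d) := by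
    intro y _
    refine integrableOn_integrand_of_continuousOn ?_ x
    have hc : Continuous fun p : Fin d → ℝ => cexp (I * phaseC (ofRealVec p) (-y)) := by
      simp_rw [phaseC_ofRealVec]; exact continuous_cexp_phase (-y)
    exact hc.continuousOn.mul (continuousOn_G_div n ha τ)
  have h1 : (fun P => G (n + 1) a 0 τ P / symbQGQ (n + 1) a P * ∑ y ∈ T, (Bf y : ℂ) * cexp (I * phaseC P (-y)))
      = fun P => ∑ y ∈ T, (Bf y : ℂ) * (cexp (I * phaseC P (-y)) * (G (n + 1) a 0 τ P / symbQGQ (n + 1) a P)) := by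
    funext P
    rw [Finset.mul_sum]
    exact Finset.sum_congr rfl fun y _ => by ring
  rw [h1, latticeKernel_sum_mul T (fun y => (Bf y : ℂ)) _ x hint]
  unfold HB
  push_cast
  refine Finset.sum_congr rfl fun y _ => ?_
  rw [kerH_chart_eq_latticeKernel n ha x y τ, latticeKernel_phase_mul, ← sub_eq_add_neg]

/-! ## §2. Bessel per block row, the fibre bound under the integral, the finitely supported headline -/

/-- each block row of `H B` is square-summable with `ℓ²`-mass at most `(2π)^{−d}∫‖(G_τ∕symbQGQ)·B̂_T‖²` (Bessel). [folklore] -/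
theorem tsum_row_sq_le (n : ℕ) {a : ℝ} (ha : 0 < a) (T : Finset (X d)) (Bf : X d → ℝ) (τ : Fin d → Fin (n + 1)) :
    (Summable fun x : X d => HB n a T Bf (chart n x τ) ^ 2) ∧
      ∑' x : X d, HB n a T Bf (chart n x τ) ^ 2 ≤ ((2 * π) ^ d)⁻¹ *
        ∫ p in BZ d, ‖G (n + 1) a 0 τ (ofRealVec p) / symbQGQ (n + 1) a (ofRealVec p)
          * ∑ y ∈ T, (Bf y : ℂ) * cexp (I * phaseC (ofRealVec p) (-y))‖ ^ 2 := by
  have heq : ∀ x : X d, HB n a T Bf (chart n x τ) ^ 2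
      = ‖latticeKernel (fun P => G (n + 1) a 0 τ P / symbQGQ (n + 1) a P
          * ∑ y ∈ T, (Bf y : ℂ) * cexp (I * phaseC P (-y))) x‖ ^ 2 := fun x => by
    rw [← HB_chart_eq_latticeKernel n ha T Bf x τ, Complex.norm_real, Real.norm_eq_abs, sq_abs]
  simp_rw [heq]
  exact ⟨summable_normSq_latticeKernel (Gm := fun P => G (n + 1) a 0 τ P / symbQGQ (n + 1) a P
      * ∑ y ∈ T, (Bf y : ℂ) * cexp (I * phaseC P (-y))) (continuousOn_rowMult n ha τ T Bf),
    tsum_normSq_latticeKernel_le (Gm := fun P => G (n + 1) a 0 τ P / symbQGQ (n + 1) a P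
      * ∑ y ∈ T, (Bf y : ℂ) * cexp (I * phaseC P (-y))) (continuousOn_rowMult n ha τ T Bf)⟩

/-- **the (40) bound under the integral**: on the zone,
`Σ_τ ‖(G_τ∕symbQGQ)(p)·B̂_T(p)‖² ≤ (n+1)^d (π²∕4)^d ‖B̂_T(p)‖²` (`Σ_τ‖G_τ‖² ≤ N^d(π²∕4)^d symbR²`, `symbQGQ = symbR` real). [folklore] -/
theorem integrand_sum_le (n : ℕ) {a : ℝ} (ha : 0 < a) (T : Finset (X d)) (Bf : X d → ℝ) (p : Fin d → ℝ) (hp : p ∈ BZ d) :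
    ∑ τ : Fin d → Fin (n + 1), ‖G (n + 1) a 0 τ (ofRealVec p) / symbQGQ (n + 1) a (ofRealVec p)
        * ∑ y ∈ T, (Bf y : ℂ) * cexp (I * phaseC (ofRealVec p) (-y))‖ ^ 2
      ≤ ((n : ℝ) + 1) ^ d * (π ^ 2 / 4) ^ d * FTsq T Bf p := by
  have hs : 0 < symbR (n + 1) a p := lt_of_lt_of_le (twoGamma0_pos d ha) (symbR_ge (n + 1) (by omega) ha p hp)
  have h1 : ∀ τ : Fin d → Fin (n + 1), ‖G (n + 1) a 0 τ (ofRealVec p) / symbQGQ (n + 1) a (ofRealVec p)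
        * ∑ y ∈ T, (Bf y : ℂ) * cexp (I * phaseC (ofRealVec p) (-y))‖ ^ 2
      = ‖G (n + 1) a 0 τ (ofRealVec p)‖ ^ 2 * (FTsq T Bf p / symbR (n + 1) a p ^ 2) := fun τ => by
    rw [norm_mul, norm_div, mul_pow, div_pow, norm_Bhat_sq, symbQGQ_ofReal, Complex.norm_real, Real.norm_eq_abs, sq_abs]
    ring
  simp_rw [h1]
  rw [← Finset.sum_mul]
  have h2 := sum_normSq_G_le (n + 1) (by omega) ha p hp
  have hF : 0 ≤ FTsq T Bf p := B5Momentum166Zd.FTsq_nonneg T Bf p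
  calc (∑ τ : Fin d → Fin (n + 1), ‖G (n + 1) a 0 τ (ofRealVec p)‖ ^ 2) * (FTsq T Bf p / symbR (n + 1) a p ^ 2)
      ≤ (((n + 1 : ℕ) : ℝ) ^ d * (π ^ 2 / 4) ^ d * symbR (n + 1) a p ^ 2) * (FTsq T Bf p / symbR (n + 1) a p ^ 2) :=
        mul_le_mul_of_nonneg_right h2 (by positivity)
    _ = ((n : ℝ) + 1) ^ d * (π ^ 2 / 4) ^ d * FTsq T Bf p := by
        push_cast
        field_simp

/-- **THE FINITELY SUPPORTED HEADLINE**: for every finite window `T ⊂ ℤ^d` and every coarse field `B`,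
`Σ′_z (Σ_{y∈T} B(y)H(z,y))² ≤ (n+1)^d (π²∕4)^d Σ_{y∈T} B(y)²` — block decomposition of the fine lattice, Bessel per block row,
(40) under the integral, and `(2π)^{−d}∫|B̂_T|² = Σ_{y∈T}B(y)²`. [folklore] -/
theorem tsum_HB_sq_le_sharp (n : ℕ) {a : ℝ} (ha : 0 < a) (T : Finset (X d)) (Bf : X d → ℝ) :
    (Summable fun z : X d => HB n a T Bf z ^ 2) ∧
      ∑' z : X d, HB n a T Bf z ^ 2 ≤ ((n : ℝ) + 1) ^ d * (π ^ 2 / 4) ^ d * ∑ y ∈ T, Bf y ^ 2 := by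
  -- summability over the fine lattice, block row by block row
  have hrow := fun τ => tsum_row_sq_le n ha T Bf τ
  have hS : Summable fun z : X d => HB n a T Bf z ^ 2 := by
    rw [← (B5Hk103ScalarZd.blockEquiv (d := d) n).summable_iff]
    have h3 : (fun z : X d => HB n a T Bf z ^ 2) ∘ (B5Hk103ScalarZd.blockEquiv (d := d) n)
        = fun yτ : X d × (Fin d → Fin (n + 1)) => HB n a T Bf (chart n yτ.1 yτ.2) ^ 2 := by
      funext yτ; rfl
    rw [h3]
    refine (summable_prod_of_nonneg (fun yτ => sq_nonneg _)).mpr ⟨fun y => (hasSum_fintype _).summable, ?_⟩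
    simp_rw [tsum_fintype]
    exact summable_sum fun τ _ => (hrow τ).1
  refine ⟨hS, ?_⟩
  -- integrability of the row integrands and of the majorant
  set g : (Fin d → Fin (n + 1)) → (Fin d → ℝ) → ℝ := fun τ p =>
    ‖G (n + 1) a 0 τ (ofRealVec p) / symbQGQ (n + 1) a (ofRealVec p)
      * ∑ y ∈ T, (Bf y : ℂ) * cexp (I * phaseC (ofRealVec p) (-y))‖ ^ 2 with hg
  have hgc : ∀ τ, ContinuousOn (g τ) (BZ d) := fun τ => by
    simp only [hg]
    exact (continuousOn_rowMult n ha τ T Bf).norm.pow 2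
  have hgi : ∀ τ, IntegrableOn (g τ) (BZ d) := fun τ => (hgc τ).integrableOn_compact isCompact_BZ
  have hmaj : IntegrableOn (fun p => ((n : ℝ) + 1) ^ d * (π ^ 2 / 4) ^ d * FTsq T Bf p) (BZ d) :=
    ((continuous_FTsq T Bf).continuousOn.integrableOn_compact isCompact_BZ).const_mul _
  -- the chain
  calc ∑' z : X d, HB n a T Bf z ^ 2
      = ∑' x : X d, ∑ q ∈ B n x, HB n a T Bf q ^ 2 := (tsum_blocks n hS).symm
    _ = ∑' x : X d, ∑ τ : Fin d → Fin (n + 1), HB n a T Bf (chart n x τ) ^ 2 :=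
        tsum_congr fun x => sum_B_eq n x _
    _ = ∑ τ : Fin d → Fin (n + 1), ∑' x : X d, HB n a T Bf (chart n x τ) ^ 2 :=
        Summable.tsum_finsetSum fun τ _ => (hrow τ).1
    _ ≤ ∑ τ : Fin d → Fin (n + 1), ((2 * π) ^ d)⁻¹ * ∫ p in BZ d, g τ p :=
        Finset.sum_le_sum fun τ _ => (hrow τ).2
    _ = ((2 * π) ^ d)⁻¹ * ∫ p in BZ d, ∑ τ : Fin d → Fin (n + 1), g τ p := by
        rw [← Finset.mul_sum, integral_finsetSum _ fun τ _ => hgi τ]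
    _ ≤ ((2 * π) ^ d)⁻¹ * ∫ p in BZ d, ((n : ℝ) + 1) ^ d * (π ^ 2 / 4) ^ d * FTsq T Bf p := by
        refine mul_le_mul_of_nonneg_left ?_ (by positivity)
        refine setIntegral_mono_on (integrable_finsetSum _ fun τ _ => hgi τ) hmaj measurableSet_BZ fun p hp => ?_
        simp only [hg]
        exact integrand_sum_le n ha T Bf p hp
    _ = ((n : ℝ) + 1) ^ d * (π ^ 2 / 4) ^ d * ∑ y ∈ T, Bf y ^ 2 := by
        rw [integral_const_mul, integral_FTsq]
        have h2π : ((2 * π) ^ d : ℝ) ≠ 0 := by positivity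
        field_simp

/-! ## §3. Square-summable data: exhaustion of `ℤ^d` by finite windows -/

/-- on a finite window of fine sites, the truncated fields `Σ_{y∈T}B(y)H(·,y)` converge to `H B` as `T ↑ ℤ^d` (every row series of
`H B` converges absolutely for `B ∈ ℓ²`). [folklore] -/
theorem tendsto_sum_HB_sq (n : ℕ) {a : ℝ} (ha : 0 < a) {Bf : X d → ℝ} (hB : Summable fun x => Bf x ^ 2)
    (W : Finset (X d)) :
    Tendsto (fun T : Finset (X d) => ∑ z ∈ W, HB n a T Bf z ^ 2) atTop (𝓝 (∑ z ∈ W, HBZd n a Bf z ^ 2)) := by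
  refine tendsto_finsetSum W fun z _ => ?_
  have h : Tendsto (fun T : Finset (X d) => HB n a T Bf z) atTop (𝓝 (HBZd n a Bf z)) :=
    (summable_HBZd_row n ha hB z).hasSum
  exact h.pow 2

/-- **THE HEADLINE — `H : ℓ²(ℤ^d) → ℓ²_η` HAS NORM AT MOST `(π∕2)^d`, EVERY MESH**: for every `n` (block side `n+1 = L^j`), every
`a > 0` and every square-summable coarse field `B`,
`Σ′_z (H B)(z)² ≤ (n+1)^d · (π²∕4)^d · Σ′_y B(y)²`
(the scalar `H` of [B5] (1.103) on `ℤ^d`, `B5Hk165L2Zd.HBZd`).  CLAIM C-ne7bp1-g111-1 in the kernel. [folklore] -/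
theorem tsum_HBZd_sq_le_sharp (n : ℕ) {a : ℝ} (ha : 0 < a) (Bf : X d → ℝ) (hB : Summable fun x => Bf x ^ 2) :
    ∑' z : X d, HBZd n a Bf z ^ 2 ≤ ((n : ℝ) + 1) ^ d * (π ^ 2 / 4) ^ d * ∑' y : X d, Bf y ^ 2 := by
  set C : ℝ := ((n : ℝ) + 1) ^ d * (π ^ 2 / 4) ^ d with hC
  have hC0 : 0 ≤ C := by positivity
  -- every finite window of fine sites carries at most `C‖B‖²`
  have hW : ∀ W : Finset (X d), ∑ z ∈ W, HBZd n a Bf z ^ 2 ≤ C * ∑' y : X d, Bf y ^ 2 := by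
    intro W
    refine le_of_tendsto (tendsto_sum_HB_sq n ha hB W) (Filter.Eventually.of_forall fun T => ?_)
    have hT := tsum_HB_sq_le_sharp n ha T Bf
    calc ∑ z ∈ W, HB n a T Bf z ^ 2 ≤ ∑' z : X d, HB n a T Bf z ^ 2 :=
          hT.1.sum_le_tsum W fun z _ => sq_nonneg _
      _ ≤ C * ∑ y ∈ T, Bf y ^ 2 := hT.2
      _ ≤ C * ∑' y : X d, Bf y ^ 2 :=
          mul_le_mul_of_nonneg_left (hB.sum_le_tsum T fun y _ => sq_nonneg _) hC0
  exact Real.tsum_le_of_sum_le (fun z => sq_nonneg _) hW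

/-- **`B5HkUniformL2Zd.tsum_HBZd_sq_le_uniform` WITH THE CONSTANT `(π²∕4)^d`**: in the `η`-weighted norm of the fine lattice,
`((n+1)^d)⁻¹ Σ′_z (H B)(z)² ≤ (π²∕4)^d Σ′_y B(y)²` for every `n`, every `a > 0`, every square-summable `B` — i.e.
`‖H_M‖_{ℓ² → ℓ²_η} ≤ (π∕2)^d` for every block side `M`. [folklore] -/
theorem tsum_HBZd_sq_le_uniform_sharp (n : ℕ) {a : ℝ} (ha : 0 < a) (Bf : X d → ℝ) (hB : Summable fun x => Bf x ^ 2) :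
    (((n : ℝ) + 1) ^ d)⁻¹ * ∑' z : X d, HBZd n a Bf z ^ 2 ≤ (π ^ 2 / 4) ^ d * ∑' y : X d, Bf y ^ 2 := by
  have hN : (0 : ℝ) < ((n : ℝ) + 1) ^ d := by positivity
  rw [inv_mul_le_iff₀ hN, ← mul_assoc]
  exact tsum_HBZd_sq_le_sharp n ha Bf hB

/-- **d = 4**: `((n+1)^4)⁻¹ Σ′_z (H B)(z)² ≤ 37.21 · Σ′_y B(y)²`, i.e. `‖H_M‖_η < 6.1` for EVERY block side `M` — below the consumer
threshold `M^{(d−2)∕2} = M` from `M = 8` on ((39) `pi_sq_div_four_pow_four_lt`). [folklore] -/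
theorem tsum_HBZd_sq_le_uniform_d4 (n : ℕ) {a : ℝ} (ha : 0 < a) (Bf : X 4 → ℝ) (hB : Summable fun x => Bf x ^ 2) :
    (((n : ℝ) + 1) ^ 4)⁻¹ * ∑' z : X 4, HBZd n a Bf z ^ 2 ≤ 37.21 * ∑' y : X 4, Bf y ^ 2 := by
  have h := tsum_HBZd_sq_le_uniform_sharp (d := 4) n ha Bf hB
  have h0 : 0 ≤ ∑' y : X 4, Bf y ^ 2 := tsum_nonneg fun y => sq_nonneg _
  have hc := pi_sq_div_four_pow_four_lt
  nlinarith

/-- the summability half, for the record: `H B ∈ ℓ²` on the fine lattice (the column's `summable_HBZd_sq`). [folklore] -/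
theorem summable_HBZd_sq' (n : ℕ) {a : ℝ} (ha : 0 < a) (Bf : X d → ℝ) (hB : Summable fun x => Bf x ^ 2) :
    Summable fun z : X d => HBZd n a Bf z ^ 2 :=
  summable_HBZd_sq n ha hB

end

end Summit.QuantumFields.BalabanUV.T4Continuum.NE7b.OneShotChartBound
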